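import Summits.BirchSwinnertonDyer.BirchSwinnertonDyer.Theorems.Rank1ResidualJetKolyvaginClassStringent
import HarnessLib

/-!
# (P2) «h49 additive» — Jetchev 2008 Prop. 4.9 (the STRINGENT condition at a bad place) for the classes of a LABELLED CM FAMILY on
# `X_{N⁺,N⁻}`: `loc_v c_M(m) ∈ δ_v(E₀(K_v))` from the label (B4) (norm relation with `p^M ∣ a_ℓ`) and the E⁰-receptacle of the family's
# Galois orbits at `v` (= tam3-p1 g12's `receptacle_of_labelB6`, p591819, i.e. the label (B6)), for ANY presentation of Kolyvagin's
# operator — abstract over `(𝒢, A₀, σ, H, f, π, j)` like bsd-jet's END (cell `bsd-stepL`, seat `bsd-stepL-tam3-p1` g12, owner of 19109's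
# line; RULING 46 (4)∕plan g38 01:26:56Z «tam3-p1: h49 additive»; `--supports stmt-BirchSwinnertonDyer-19109 --as helper`)

WHAT. pv-1's `JET.exists_localKummerMap_eq_res_kolyvaginClass_concrete_of_GZ31_zhang` (`Rank1ResidualJetKolyvaginClassStringent`) proves the
stringent condition for the `X₀(N)` datum by assembling bsd-jet's ABSTRACT END `JET.Stringent.exists_localKummerMap_eq_res_kolyvaginClass_kolyvaginPoint_of_GZ31`
+ the strong Milne I.3.8 `JET.StrongMilne.exists_mem_E0Receptacle_eq_smul_sub` with: x11b3-p2's level data, Gross Prop. 3.6 for the concrete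
points, the Heegner trace relation `Tr_ℓ y(m) = a_ℓ y(m/ℓ)↑` from GZ∕Eichler–Shimura print, and [GZ86 III (3.1)] in the receptacle form `hGZ`.
THIS FILE is the same assembly for an ARBITRARY presentation `(𝒢 ↷ A₀, σ, H, f, π, j)` of a labelled family at level `m` (the shape of
corner3-p2 g5's carrier ∕ `ShimuraWalk.PDiv`'s presentations), with the X₀(N)-specific inputs replaced by HYPOTHESES of label shape:
* `htrace` ∕ `ha` — (B4) in operator currency `Tr_{σ_ℓ} y = a_ℓ • z_ℓ` with `p^M ∣ a_ℓ` (`z_ℓ` = the level-`m/ℓ` point read in `A₀`);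
* `hrec` — the receptacle on the `𝒢`-orbits of `y` and of the `z_ℓ` at `v`: `n' • (j (γ • y))_v, n' • (j (γ • z_ℓ))_v ∈ E⁰(K̄_v)`, `n'` prime
  to `p^M` — VERBATIM the conclusion of `ShimuraKolyvaginOfImage.receptacle_of_labelB6` read through `j = E(e)` (the label (B6));
* `hA` (admissibility of `j(A₀)`), `hP` (invariance of `j P_m` mod `p^M`), `hI` (local inertia at `v ∤ m` fixes `j P_m`) — the three standing
  inputs, all outputs of corner3-p2's family glue (`isAdmissible_range_of_galoisEquivariant`, `map_kolyvaginPoint_mem_invPoints`,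
  `resGal_smul_map_eq_self_of_galoisDictionary`).
Results: `exists_localKummerMap_eq_res_kolyvaginClass_of_orbitReceptacle` (∃ `t ∈ E(K_v)` with `e(t) ∈ E⁰(K̄_v)` and `δ_v(t) = res_v c_M(m)`)
and, at a place where `W ⊗ K_v` is minimal, **`localization_kolyvaginClass_mem_stringentFamily_of_orbitReceptacle`**: `loc_v c_M(m) ∈
JET.stringentFamily W K hn (Sum.inr v)` — the `h49str` ∕ `h𝒮Q` input of the walk's supply (`Walk.exists_carrierPackage_kolyvagin`) for the
labelled classes. HONEST FRAMING: THEOREMS ONLY (no definition, no named fact, no `sorry`); CONDITIONAL on the displayed label-shaped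
hypotheses; nothing about any CM point is constructed; no item closes; BSD is not proved by any of this.
References: [cite: Jetchev2008, Def. 4.8, Prop. 4.9 (arXiv) = Prop. 4.1 (pp. 819–821), §3.1 (p. 814)] [cite: GrossLMS1991, §3 Prop. 3.6–3.7, §6 Prop. 6.2 (1) (pp. 244–245)]
[cite: MilneADT2006, Ch. I Prop. 3.8] [cite: McCallumLMS1991, Lemma 4.3, §4 (4)–(6)] [cite: BertoliniDarmon1996, §2.4] [cite: Zhang2001Heights, §4.4 Case 2].
presearch: not applicable (assembly of tree theorems); `lean search 'of_orbitReceptacle'` → none.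
-/

set_option autoImplicit false
set_option linter.dupNamespace false

noncomputable section

open scoped Classical
open scoped AddSubgroup

namespace Summit.BirchSwinnertonDyer.BirchSwinnertonDyer.Theorems.ShimuraKolyvaginOfImage

open WeierstrassCurve Field NumberField IsDedekindDomain Finset
  Literature.NumberTheory.EllipticCurves Literature.NumberTheory.GaloisRepresentations
  Literature.NumberTheory.EllipticCurves.KolyvaginCocycle Literature.NumberTheory.EllipticCurves.KolyvaginEuler
  Summit.BirchSwinnertonDyer.Rank1Residual.X11b Summit.BirchSwinnertonDyer.Rank1Residual.X11b.Three
  Summit.BirchSwinnertonDyer.Rank1Residual.X11b.Three.GrossBadPlace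
  Summit.BirchSwinnertonDyer.Rank1Residual.X11b.KolyvaginHloc
  Summit.BirchSwinnertonDyer.Rank1Residual.JET

variable {K : Type} [Field K] [NumberField K] {W : WeierstrassCurve ℚ} [W.IsElliptic]
  {𝒢 : Type*} [CommGroup 𝒢] {A₀ : Type*} [AddCommGroup A₀] [DistribMulAction 𝒢 A₀]

/-- **Jetchev Prop. 4.9 at a bad place for a presented labelled family, END FORM.** Abstract datum: a commutative group `𝒢` acting on
`A₀` («`Gal(K[m]/K)` on `E(K[m])`»), generators `σ_ℓ` (`ℓ ∈ L`, `σ_ℓ^{ℓ+1} = 1`, `p^M ∣ ℓ+1`), a subgroup `H ≤ ⟨σ_ℓ⟩` with a section `f`,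
a Galois map `π` and an equivariant embedding `j : A₀ → E(K̄)` with admissible image, the point `y ∈ A₀` with Kolyvagin point
`P = P(σ, L, f, y)` invariant mod `p^M` and fixed by the local inertia at the bad place `v`; LABELS: (B4) `Tr_{σ_ℓ} y = a_ℓ • z_ℓ` with
`p^M ∣ a_ℓ`, and the receptacle `n' • (j(γ • y))_v, n' • (j(γ • z_ℓ))_v ∈ E⁰(K̄_v)` for all `γ ∈ 𝒢`, `n'` prime to `p^M`. CONCLUSION:
`res_v c_M(P) = δ_v(t)` for some `t ∈ E(K_v)` whose image lies in `E⁰(K̄_v)`. Proof: bsd-jet's abstract END with `E′ :=` the subgroup generated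
by the orbits of `y` and the `z_ℓ` (𝒢-stable; `Tr_ℓ y = a_ℓ z_ℓ ∈ p^M E′`; receptacle on generators ⇒ on `E′`) and the strong Milne I.3.8 at the
bad place. [cite: Jetchev2008, Prop. 4.9 (arXiv) = Prop. 4.1 (pp. 819–821)] [cite: GrossLMS1991, §6 Prop. 6.2 (1)] [cite: MilneADT2006, Ch. I Prop. 3.8] -/
theorem exists_localKummerMap_eq_res_kolyvaginClass_of_orbitReceptacle
    {p M : ℕ} (hn : ((p ^ M : ℕ) : ℤ) ≠ 0)
    (hdiv : ∀ P : geomPoints (W.baseChange K), ∃ Q : geomPoints (W.baseChange K), ((p ^ M : ℕ) : ℤ) • Q = P)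
    {σ : ℕ → 𝒢} {L : Finset ℕ} {H : Subgroup 𝒢} [Fintype (𝒢 ⧸ H)] {f : 𝒢 ⧸ H → 𝒢}
    (hf : ∀ q, (f q : 𝒢 ⧸ H) = q) (hgen : H ≤ Subgroup.closure (σ '' (L : Set ℕ)))
    (hord : ∀ ℓ ∈ L, σ ℓ ^ (ℓ + 1) = 1) (hdvd : ∀ ℓ ∈ L, ((p ^ M : ℕ) : ℤ) ∣ ((ℓ + 1 : ℕ) : ℤ))
    {y : A₀} (π : absoluteGaloisGroup K →* 𝒢) (j : A₀ →+ geomPoints (W.baseChange K))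
    (hj : ∀ (g : absoluteGaloisGroup K) (a : A₀), j (π g • a) = g • j a)
    (hA : IsAdmissible (absoluteGaloisGroup K) j.range ((p ^ M : ℕ) : ℤ))
    (hP : j (kolyvaginPoint σ L f y) ∈ invPoints (absoluteGaloisGroup K) j.range ((p ^ M : ℕ) : ℤ))
    (v : HeightOneSpectrum (𝓞 K)) (hbad : ¬ (W.baseChange K).HasGoodReductionAt v)
    {𝔐 : Ideal (v.localAbsIntegers)} (h𝔐 : 𝔐 ∈ v.localPrimesAbove)
    (hI : ∀ τ ∈ 𝔐.inertia (absoluteGaloisGroup (v.adicCompletion K)),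
      resGal (K := K) (v.adicCompletion K) τ • j (kolyvaginPoint σ L f y) = j (kolyvaginPoint σ L f y))
    -- LABELS: (B4) with (3.3), and the receptacle on the orbits (B6)
    (z : ℕ → A₀) (a : ℕ → ℤ) (htrace : ∀ ℓ ∈ L, grAct A₀ (traceElt (σ ℓ) ℓ) y = a ℓ • z ℓ)
    (ha : ∀ ℓ ∈ L, ((p ^ M : ℕ) : ℤ) ∣ a ℓ)
    {n' : ℤ} (hcop : IsCoprime ((p ^ M : ℕ) : ℤ) n')
    (hrec : ∀ γ : 𝒢, n' • pointsMap (W.baseChange K) (v.adicCompletion K) (j (γ • y)) ∈ E0Receptacle (W.baseChange K) v ∧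
      ∀ ℓ ∈ L, n' • pointsMap (W.baseChange K) (v.adicCompletion K) (j (γ • z ℓ)) ∈ E0Receptacle (W.baseChange K) v) :
    ∃ t : ((W.baseChange K).baseChange (v.adicCompletion K)).toAffine.Point,
      (W.baseChange K).baseChangeGeomPointsEquiv (v.adicCompletion K)
          (toGeomPoints ((W.baseChange K).baseChange (v.adicCompletion K)) t) ∈ E0Receptacle (W.baseChange K) v ∧
        (W.baseChange K).localKummerMap (v.adicCompletion K) hn t =
          galoisCohomology.res ((W.baseChange K).torsionGaloisModule ((p ^ M : ℕ) : ℤ)) (v.adicCompletion K) 1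
            (kolyvaginClass (W.baseChange K) ((p ^ M : ℕ) : ℤ) hdiv hA (j (kolyvaginPoint σ L f y)) hP) := by
  -- `E′`: generated by the `𝒢`-orbits of `y` and of the `z_ℓ`
  set S : Set A₀ := {x | ∃ γ : 𝒢, x = γ • y ∨ ∃ ℓ ∈ L, x = γ • z ℓ} with hSdef
  have hSstab : ∀ (g : 𝒢), ∀ s ∈ S, g • s ∈ S := by
    rintro g s ⟨γ, h | ⟨ℓ, hℓ, h⟩⟩
    · refine ⟨g * γ, Or.inl ?_⟩
      rw [h]; exact (mul_smul g γ _).symm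
    · refine ⟨g * γ, Or.inr ⟨ℓ, hℓ, ?_⟩⟩
      rw [h]; exact (mul_smul g γ _).symm
  have hyS : y ∈ S := ⟨1, Or.inl (one_smul _ _).symm⟩
  have hzS : ∀ ℓ ∈ L, z ℓ ∈ S := fun ℓ hℓ ↦ ⟨1, Or.inr ⟨ℓ, hℓ, (one_smul _ _).symm⟩⟩
  -- the receptacle on the generators
  have hrecS : ∀ s ∈ S, n' • pointsMap (W.baseChange K) (v.adicCompletion K) (j s) ∈ E0Receptacle (W.baseChange K) v := by
    rintro s ⟨γ, h | ⟨ℓ, hℓ, h⟩⟩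
    · rw [h]; exact (hrec γ).1
    · rw [h]; exact (hrec γ).2 ℓ hℓ
  -- `Tr_ℓ y = a_ℓ • z_ℓ ∈ p^M · E′`
  have htr : ∀ ℓ ∈ L, grAct A₀ (traceElt (σ ℓ) ℓ) y ∈
      (AddSubgroup.closure S).map (zsmulAddGroupHom ((p ^ M : ℕ) : ℤ) : A₀ →+ A₀) := by
    intro ℓ hℓ
    obtain ⟨k, hk⟩ := ha ℓ hℓ
    refine AddSubgroup.mem_map.mpr ⟨k • z ℓ, AddSubgroup.zsmul_mem _ (AddSubgroup.subset_closure (hzS ℓ hℓ)) k, ?_⟩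
    rw [zsmulAddGroupHom_apply, smul_smul, ← hk, htrace ℓ hℓ]
  -- bsd-jet's abstract END at the bad place, the strong Milne I.3.8 closing the coboundary
  exact Stringent.exists_localKummerMap_eq_res_kolyvaginClass_kolyvaginPoint_of_GZ31 (W.baseChange K) hn hf hgen hord hdvd π j hj
    hA hP v hI (E0Receptacle (W.baseChange K) v) (E' := AddSubgroup.closure S) (n' := n')
    ⟨fun γ e he ↦ smul_mem_closure_of_forall_smul_mem hSstab γ he, AddSubgroup.subset_closure hyS, htr,
      fun x hx ↦ zsmul_map_mem_of_mem_closure ((pointsMap (W.baseChange K) (v.adicCompletion K)).comp j)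
        (E0Receptacle (W.baseChange K) v) n' hrecS hx⟩
    hcop (fun c hcB hcI ↦ StrongMilne.exists_mem_E0Receptacle_eq_smul_sub (W.baseChange K) v hbad h𝔐 c hcB hcI)

/-- **`h49str` for a presented labelled family: `loc_v c_M(m) ∈ 𝒮_v`** (`𝒮 = JET.stringentFamily W K hn`, the connected Kummer condition
`δ_v(E₀(K_v))`) at a finite BAD place `v ∤ m` where `W ⊗ K_v` is a minimal equation — from the END above, reading `e(t) ∈ E⁰(K̄_v)` on the
rational point (`Receptacle.mem_goodReductionSubgroup_of_mem_E0Receptacle`). Same label-shaped hypotheses; this is the family-side `h𝒮Q` input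
of the walk's carrier package (`Walk.exists_carrierPackage_kolyvagin`) at the carrier places. [cite: Jetchev2008, Def. 4.8, Prop. 4.9; §3.1 (p. 814)]
[cite: GrossLMS1991, §6 Prop. 6.2 (1)] [cite: MilneADT2006, Ch. I Prop. 3.8] -/
theorem localization_kolyvaginClass_mem_stringentFamily_of_orbitReceptacle
    {p M : ℕ} (hn : ((p ^ M : ℕ) : ℤ) ≠ 0)
    (hdiv : ∀ P : geomPoints (W.baseChange K), ∃ Q : geomPoints (W.baseChange K), ((p ^ M : ℕ) : ℤ) • Q = P)
    {σ : ℕ → 𝒢} {L : Finset ℕ} {H : Subgroup 𝒢} [Fintype (𝒢 ⧸ H)] {f : 𝒢 ⧸ H → 𝒢}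
    (hf : ∀ q, (f q : 𝒢 ⧸ H) = q) (hgen : H ≤ Subgroup.closure (σ '' (L : Set ℕ)))
    (hord : ∀ ℓ ∈ L, σ ℓ ^ (ℓ + 1) = 1) (hdvd : ∀ ℓ ∈ L, ((p ^ M : ℕ) : ℤ) ∣ ((ℓ + 1 : ℕ) : ℤ))
    {y : A₀} (π : absoluteGaloisGroup K →* 𝒢) (j : A₀ →+ geomPoints (W.baseChange K))
    (hj : ∀ (g : absoluteGaloisGroup K) (a : A₀), j (π g • a) = g • j a)
    (hA : IsAdmissible (absoluteGaloisGroup K) j.range ((p ^ M : ℕ) : ℤ))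
    (hP : j (kolyvaginPoint σ L f y) ∈ invPoints (absoluteGaloisGroup K) j.range ((p ^ M : ℕ) : ℤ))
    (v : HeightOneSpectrum (𝓞 K)) (hbad : ¬ (W.baseChange K).HasGoodReductionAt v)
    [hmin : ((W.baseChange K).baseChange (v.adicCompletion K)).IsMinimal (v.adicCompletionIntegers K)]
    {𝔐 : Ideal (v.localAbsIntegers)} (h𝔐 : 𝔐 ∈ v.localPrimesAbove)
    (hI : ∀ τ ∈ 𝔐.inertia (absoluteGaloisGroup (v.adicCompletion K)),
      resGal (K := K) (v.adicCompletion K) τ • j (kolyvaginPoint σ L f y) = j (kolyvaginPoint σ L f y))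
    (z : ℕ → A₀) (a : ℕ → ℤ) (htrace : ∀ ℓ ∈ L, grAct A₀ (traceElt (σ ℓ) ℓ) y = a ℓ • z ℓ)
    (ha : ∀ ℓ ∈ L, ((p ^ M : ℕ) : ℤ) ∣ a ℓ)
    {n' : ℤ} (hcop : IsCoprime ((p ^ M : ℕ) : ℤ) n')
    (hrec : ∀ γ : 𝒢, n' • pointsMap (W.baseChange K) (v.adicCompletion K) (j (γ • y)) ∈ E0Receptacle (W.baseChange K) v ∧
      ∀ ℓ ∈ L, n' • pointsMap (W.baseChange K) (v.adicCompletion K) (j (γ • z ℓ)) ∈ E0Receptacle (W.baseChange K) v) :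
    galoisCohomology.localization ((W.baseChange K).torsionGaloisModule ((p ^ M : ℕ) : ℤ)) (Sum.inr v) 1
        (kolyvaginClass (W.baseChange K) ((p ^ M : ℕ) : ℤ) hdiv hA (j (kolyvaginPoint σ L f y)) hP) ∈
      stringentFamily W K hn (Sum.inr v) := by
  haveI : CharZero (v.adicCompletion K) := charZero_of_injective_algebraMap (algebraMap K _).injective
  obtain ⟨t, htE, ht⟩ := exists_localKummerMap_eq_res_kolyvaginClass_of_orbitReceptacle hn hdiv hf hgen hord hdvd π j hj hA hP v
    hbad h𝔐 hI z a htrace ha hcop hrec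
  rw [stringentFamily_inr_of_isMinimal W K hn v]
  exact (JetchevKummer.mem_connectedKummerCondition_iff (W.baseChange K) (v.adicCompletion K)
    (v.adicCompletionIntegers K) hn _).mpr
    ⟨t, Receptacle.mem_goodReductionSubgroup_of_mem_E0Receptacle (W.baseChange K) v t htE, ht⟩

end Summit.BirchSwinnertonDyer.BirchSwinnertonDyer.Theorems.ShimuraKolyvaginOfImage

end
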